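import Mathlib
import Literature.Computability.Complexity.CliqueTestGraphs
import Summits.PneNP.PneNP.Theorems.ConvexRankGatesConvexGateBlindFewVariables
import Summits.PneNP.PneNP.Theorems.ConvexRankGatesConvexGateBlindOneGate

/-!
# PneNP / ConvexRankGates — `ConvexGateBlind`: an LP gate for CLIQUE factorises the clique-distance matrix

Helpers (`--supports stmt-PneNP-10680`): the LP half of the crux against its CANONICAL matrix. Let
`D[Q, u] = #(E(Q) ∖ u)` be the one-sided distance from the `k`-clique `Q` to the `k`-clique-free graph `u`
(Hrubeš's `M_+(CLIQUE)`; every entry `≥ 1`). If one monotone LP-feasibility gate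
`x ↦ [∃ z ≥ 0, A z ≤ b + B x]` (`B ≥ 0`, `p` rows, `q` variables) computes `CLIQUE(m, k)`, then for some
`ε > 0` the shifted matrix `D - ε J` has an EXPLICIT non-negative factorisation with `p + q + 2 #E + 1`
terms (`lpGate_cliqueDist_factorisation`): per rejected `u` take a normalised Farkas certificate `y_u`
(`exists_mem_certPolytope_of_infeasible`), `w_u = Bᵀ y_u`, `θ_u = -y_u · b`, `W_u = 1 + ∑ w_u`,
`ε_u = (θ_u - w_u · u)/W_u > 0`; then
`W_u D[Q,u] - (θ_u - w_u·u) = (w_u · 1_Q - θ_u) + ∑_{e ∉ u} (W_u - w_u(e)) [e ∈ Q] + ∑_{e ∈ u} w_u(e) [e ∉ Q]`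
and `w_u · 1_Q - θ_u = y_u · slack_Q + (y_uᵀ A) · z_Q` (weak duality made exact) — all products of
non-negatives; `ε = min_u ε_u`. Hence (`lpDataHard_of_cliqueDist_rankHard`): if for every `c` eventually
every `ε > 0` has `rk_+(D - ε J) > m^c` (`k = ⌈m^δ⌉₊`), then no LP data of size `m^c` compute
`CLIQUE(m, ⌈m^δ⌉₊)` — the LP slice of the crux follows from an ε-sensitive non-negative-rank bound for ONE
explicit matrix family, exactly Hrubeš's formulation (Thm. 20, Open Problems 3–4) and the target of the
idea card `strict-rank-conic-cover`. [folklore specialisation of Hrubeš 2020 (bib `Hrubes2020`, ECCC TR19-034), Thm. 20 and its proof, pp. 16–17]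
-/

namespace Summit.PneNP.PneNP.Theorems

open Matrix Finset Literature.Computability.Complexity

/-- **An LP gate computing CLIQUE factorises `D - εJ` non-negatively** (`D[Q,u] = #(E(Q) ∖ u)`), with
terms indexed by `(Fin p ⊕ Fin q) ⊕ ((E ⊕ E) ⊕ Unit)` (`p + q + 2 #E + 1` of them) and some `ε > 0`;
everything explicit from the Farkas certificates of the rejected inputs (module docstring).
[folklore; the CLIQUE instance of Hrubeš 2020 (`Hrubes2020`), Thm. 20, direction "separator ⇒ small rank"] -/
theorem lpGate_cliqueDist_factorisation {m k p q : ℕ} (A : Fin p → Fin q → ℝ) (b : Fin p → ℝ)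
    (B : Fin p → (⊤ : SimpleGraph (Fin m)).edgeSet → ℝ) (hB : ∀ i e, 0 ≤ B i e)
    (hcomp : ∀ x : (⊤ : SimpleGraph (Fin m)).edgeSet → Bool, cliqueFn m k x = true ↔
      ∃ z : Fin q → ℝ, (∀ j, 0 ≤ z j) ∧ ∀ i, ∑ j, A i j * z j ≤ b i + ∑ e, B i e * (if x e then (1 : ℝ) else 0)) :
    ∃ ε : ℝ, 0 < ε ∧ ∃ (U : ((⊤ : SimpleGraph (Fin m)).edgeSet → Bool) → ((Fin p ⊕ Fin q) ⊕ (((⊤ : SimpleGraph (Fin m)).edgeSet ⊕ (⊤ : SimpleGraph (Fin m)).edgeSet) ⊕ Unit)) → ℝ) (V : ((Fin p ⊕ Fin q) ⊕ (((⊤ : SimpleGraph (Fin m)).edgeSet ⊕ (⊤ : SimpleGraph (Fin m)).edgeSet) ⊕ Unit)) → Finset (Fin m) → ℝ),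
      (∀ u l, 0 ≤ U u l) ∧ (∀ l Q, 0 ≤ V l Q) ∧
      ∀ (Q : Finset (Fin m)) (u : (⊤ : SimpleGraph (Fin m)).edgeSet → Bool), Q.card = k → cliqueFn m k u = false →
        (∑ e, if cliqueVec Q e = true ∧ u e = false then (1 : ℝ) else 0) - ε = ∑ l, U u l * V l Q := by
  classical
  -- right-hand sides
  set r : ((⊤ : SimpleGraph (Fin m)).edgeSet → Bool) → Fin p → ℝ := fun x i => b i + ∑ e, B i e * (if x e then (1 : ℝ) else 0) with hr
  -- certificates of the rejected (= clique-free) inputs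
  have hcert : ∀ u : (⊤ : SimpleGraph (Fin m)).edgeSet → Bool, ∃ y : Fin p → ℝ, cliqueFn m k u = false →
      (∀ i, 0 ≤ y i) ∧ (∀ j, 0 ≤ ∑ i, y i * A i j) ∧ ∑ i, y i * r u i < 0 := by
    intro u
    by_cases hu : cliqueFn m k u = false
    · have hinf : ¬ ∃ z : Fin q → ℝ, (∀ j, 0 ≤ z j) ∧ ∀ i, ∑ j, A i j * z j ≤ r u i := by
        intro hz'
        have h := (hcomp u).2 hz'
        rw [hu] at h
        exact Bool.noConfusion h
      obtain ⟨y, ⟨hy1, hy2, -⟩, hneg⟩ := exists_mem_certPolytope_of_infeasible A (r u) hinf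
      exact ⟨y, fun _ => ⟨hy1, hy2, hneg⟩⟩
    · exact ⟨0, fun h => absurd h hu⟩
  choose y hy using hcert
  -- witnesses of the clique vectors
  have hwit : ∀ Q : Finset (Fin m), ∃ z : Fin q → ℝ, Q.card = k →
      (∀ j, 0 ≤ z j) ∧ ∀ i, ∑ j, A i j * z j ≤ r (cliqueVec Q) i := by
    intro Q
    by_cases hQ : Q.card = k
    · obtain ⟨z, hz, hrows⟩ := (hcomp _).1 (cliqueFn_cliqueVec hQ.ge)
      exact ⟨z, fun _ => ⟨hz, hrows⟩⟩
    · exact ⟨0, fun h => absurd h hQ⟩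
  choose z hz using hwit
  -- derived data
  let w : ((⊤ : SimpleGraph (Fin m)).edgeSet → Bool) → (⊤ : SimpleGraph (Fin m)).edgeSet → ℝ := fun u e => ∑ i, y u i * B i e
  let θ : ((⊤ : SimpleGraph (Fin m)).edgeSet → Bool) → ℝ := fun u => -∑ i, y u i * b i
  let W : ((⊤ : SimpleGraph (Fin m)).edgeSet → Bool) → ℝ := fun u => 1 + ∑ e, w u e
  let εu : ((⊤ : SimpleGraph (Fin m)).edgeSet → Bool) → ℝ := fun u => (θ u - ∑ e, w u e * (if u e then (1 : ℝ) else 0)) / W u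
  have hw0 : ∀ u, cliqueFn m k u = false → ∀ e, 0 ≤ w u e :=
    fun u hu e => Finset.sum_nonneg fun i _ => mul_nonneg ((hy u hu).1 i) (hB i e)
  have hW : ∀ u, cliqueFn m k u = false → 0 < W u := by
    intro u hu
    have : 0 ≤ ∑ e, w u e := Finset.sum_nonneg fun e _ => hw0 u hu e
    simp only [W]
    linarith
  have hwW : ∀ u, cliqueFn m k u = false → ∀ e, w u e ≤ W u := by
    intro u hu e
    have : w u e ≤ ∑ e, w u e := Finset.single_le_sum (fun e _ => hw0 u hu e) (Finset.mem_univ e)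
    simp only [W]
    linarith
  -- the value of the certificate at an input
  have hval : ∀ u x, ∑ i, y u i * r x i = ∑ e, w u e * (if x e then (1 : ℝ) else 0) - θ u := by
    intro u x
    simp only [hr, w, θ]
    rw [sum_mul_rows_eq]
    ring
  have hεu : ∀ u, cliqueFn m k u = false → 0 < εu u := by
    intro u hu
    have h := (hy u hu).2.2
    rw [hval] at h
    exact div_pos (by linarith) (hW u hu)
  -- the uniform margin
  have hε : ∃ ε : ℝ, 0 < ε ∧ ∀ u, cliqueFn m k u = false → ε ≤ εu u := by
    by_cases hex : ∃ u : (⊤ : SimpleGraph (Fin m)).edgeSet → Bool, cliqueFn m k u = false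
    · have hne : (univ.filter fun u : (⊤ : SimpleGraph (Fin m)).edgeSet → Bool => cliqueFn m k u = false).Nonempty := by
        obtain ⟨u, hu⟩ := hex
        exact ⟨u, Finset.mem_filter.2 ⟨Finset.mem_univ _, hu⟩⟩
      obtain ⟨u₀, hu₀, hmin⟩ := Finset.exists_min_image _ εu hne
      exact ⟨εu u₀, hεu u₀ (Finset.mem_filter.1 hu₀).2, fun u hu =>
        hmin u (Finset.mem_filter.2 ⟨Finset.mem_univ _, hu⟩)⟩
    · exact ⟨1, one_pos, fun u hu => absurd ⟨u, hu⟩ hex⟩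
  obtain ⟨ε, hε0, hεle⟩ := hε
  refine ⟨ε, hε0, ?_⟩
  -- the factors (zero outside the relevant rows / columns)
  let Uf : ((⊤ : SimpleGraph (Fin m)).edgeSet → Bool) → ((Fin p ⊕ Fin q) ⊕ (((⊤ : SimpleGraph (Fin m)).edgeSet ⊕ (⊤ : SimpleGraph (Fin m)).edgeSet) ⊕ Unit)) → ℝ := fun u l => if cliqueFn m k u = false then Sum.elim
      (Sum.elim (fun i => y u i / W u) (fun j => (∑ i, y u i * A i j) / W u))
      (Sum.elim (Sum.elim (fun e => if u e then 0 else (W u - w u e) / W u)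
        (fun e => if u e then w u e / W u else 0)) (fun _ => εu u - ε)) l else 0
  let Vf : ((Fin p ⊕ Fin q) ⊕ (((⊤ : SimpleGraph (Fin m)).edgeSet ⊕ (⊤ : SimpleGraph (Fin m)).edgeSet) ⊕ Unit)) → Finset (Fin m) → ℝ := fun l Q => if Q.card = k then Sum.elim
      (Sum.elim (fun i => r (cliqueVec Q) i - ∑ j, A i j * z Q j) (fun j => z Q j))
      (Sum.elim (Sum.elim (fun e => if cliqueVec Q e then (1 : ℝ) else 0)
        (fun e => if cliqueVec Q e then (0 : ℝ) else 1)) (fun _ => 1)) l else 0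
  refine ⟨Uf, Vf, fun u l => ?_, fun l Q => ?_, fun Q u hQ hu => ?_⟩
  · by_cases hu : cliqueFn m k u = false
    · simp only [Uf, if_pos hu]
      rcases l with (i | j) | ((e | e) | _)
      · exact div_nonneg ((hy u hu).1 i) (hW u hu).le
      · exact div_nonneg ((hy u hu).2.1 j) (hW u hu).le
      · simp only [Sum.elim_inl, Sum.elim_inr]
        split_ifs
        · exact le_rfl
        · exact div_nonneg (by linarith [hwW u hu e]) (hW u hu).le
      · simp only [Sum.elim_inl, Sum.elim_inr]
        split_ifs
        · exact div_nonneg (hw0 u hu e) (hW u hu).le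
        · exact le_rfl
      · simp only [Sum.elim_inr, sub_nonneg]
        exact hεle u hu
    · simp only [Uf, if_neg hu]
      exact le_rfl
  · by_cases hQ : Q.card = k
    · simp only [Vf, if_pos hQ]
      rcases l with (i | j) | ((e | e) | _)
      · simp only [Sum.elim_inl, sub_nonneg]
        exact (hz Q hQ).2 i
      · exact (hz Q hQ).1 j
      · simp only [Sum.elim_inl, Sum.elim_inr]
        split_ifs <;> norm_num
      · simp only [Sum.elim_inl, Sum.elim_inr]
        split_ifs <;> norm_num
      · simp only [Sum.elim_inr]
        norm_num
    · simp only [Vf, if_neg hQ]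
      exact le_rfl
  · -- the identity `D[Q,u] - ε = ∑ U V`
    have hWpos := hW u hu
    have hWne : W u ≠ 0 := hWpos.ne'
    simp only [Uf, Vf, if_pos hu, if_pos hQ, Fintype.sum_sum_type, Sum.elim_inl, Sum.elim_inr,
      Finset.univ_unique, Finset.sum_singleton]
    -- first block: weak duality made exact
    have S1 : ∑ i, y u i / W u * (r (cliqueVec Q) i - ∑ j, A i j * z Q j) +
        ∑ j, (∑ i, y u i * A i j) / W u * z Q j = (∑ i, y u i * r (cliqueVec Q) i) / W u := by
      have hswap : ∑ j, (∑ i, y u i * A i j) / W u * z Q j = ∑ i, y u i / W u * ∑ j, A i j * z Q j := by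
        simp only [Finset.sum_div, Finset.sum_mul, Finset.mul_sum]
        rw [Finset.sum_comm]
        exact Finset.sum_congr rfl fun i _ => Finset.sum_congr rfl fun j _ => by ring
      rw [hswap, ← Finset.sum_add_distrib, Finset.sum_div]
      exact Finset.sum_congr rfl fun i _ => by ring
    -- second block: edge by edge
    have S2 : ∀ e : (⊤ : SimpleGraph (Fin m)).edgeSet, (if u e then 0 else (W u - w u e) / W u) * (if cliqueVec Q e then (1 : ℝ) else 0) +
        (if u e then w u e / W u else 0) * (if cliqueVec Q e then (0 : ℝ) else 1) =
        (W u * (if cliqueVec Q e = true ∧ u e = false then (1 : ℝ) else 0)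
          - w u e * (if cliqueVec Q e then (1 : ℝ) else 0) + w u e * (if u e then (1 : ℝ) else 0)) / W u := by
      intro e
      cases hue : u e <;> cases hQe : cliqueVec Q e <;> simp
    have S2sum : ∑ e : (⊤ : SimpleGraph (Fin m)).edgeSet, ((if u e then 0 else (W u - w u e) / W u) * (if cliqueVec Q e then (1 : ℝ) else 0)) +
        ∑ e : (⊤ : SimpleGraph (Fin m)).edgeSet, ((if u e then w u e / W u else 0) * (if cliqueVec Q e then (0 : ℝ) else 1)) =
        (W u * (∑ e, if cliqueVec Q e = true ∧ u e = false then (1 : ℝ) else 0)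
          - ∑ e, w u e * (if cliqueVec Q e then (1 : ℝ) else 0) + ∑ e, w u e * (if u e then (1 : ℝ) else 0)) / W u := by
      rw [← Finset.sum_add_distrib, Finset.sum_congr rfl fun e _ => S2 e, ← Finset.sum_div, Finset.sum_add_distrib,
        Finset.sum_sub_distrib, Finset.mul_sum]
    rw [S1, S2sum, mul_one, hval u (cliqueVec Q)]
    simp only [εu]
    field_simp
    ring

/-- **The LP slice of the crux from an ε-sensitive rank bound on ONE matrix family.** If for every `c`,
eventually in `m`, the shifted clique-distance matrix `D - εJ` of `CLIQUE(m, ⌈m^δ⌉₊)`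
(`D[Q,u] = #(E(Q) ∖ u)`, `Q` the `⌈m^δ⌉₊`-sets, `u` the `⌈m^δ⌉₊`-clique-free graphs) has NO non-negative
factorisation with `≤ m^c` terms for ANY `ε > 0`, then for every `c`, eventually, no LP data with
`p + q ≤ m^c` compute `CLIQUE(m, ⌈m^δ⌉₊)` (contrapositive of `lpGate_cliqueDist_factorisation`, whose
`p + q + 2#E + 1 ≤ m^{c+3}` terms are re-indexed by `Fin`). [folklore; cf. Hrubeš 2020 (`Hrubes2020`), Thm. 20] -/
theorem lpDataHard_of_cliqueDist_rankHard (δ : ℝ)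
    (h : ∀ c : ℕ, ∀ᶠ m : ℕ in Filter.atTop, ∀ ε : ℝ, 0 < ε → ∀ r : ℕ, r ≤ m ^ c →
      ∀ (U : ((⊤ : SimpleGraph (Fin m)).edgeSet → Bool) → Fin r → ℝ) (V : Fin r → Finset (Fin m) → ℝ),
        (∀ u l, 0 ≤ U u l) → (∀ l Q, 0 ≤ V l Q) →
        ¬ ∀ (Q : Finset (Fin m)) (u : (⊤ : SimpleGraph (Fin m)).edgeSet → Bool), Q.card = ⌈(m : ℝ) ^ δ⌉₊ →
            cliqueFn m ⌈(m : ℝ) ^ δ⌉₊ u = false →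
              (∑ e, if cliqueVec Q e = true ∧ u e = false then (1 : ℝ) else 0) - ε = ∑ l, U u l * V l Q) :
    ∀ c : ℕ, ∀ᶠ m : ℕ in Filter.atTop, ∀ (p q : ℕ), p + q ≤ m ^ c →
      ∀ (A : Fin p → Fin q → ℝ) (b : Fin p → ℝ) (B : Fin p → (⊤ : SimpleGraph (Fin m)).edgeSet → ℝ), (∀ i e, 0 ≤ B i e) →
        ¬ ∀ x : (⊤ : SimpleGraph (Fin m)).edgeSet → Bool, cliqueFn m ⌈(m : ℝ) ^ δ⌉₊ x = true ↔
          ∃ z : Fin q → ℝ, (∀ j, 0 ≤ z j) ∧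
            ∀ i, ∑ j, A i j * z j ≤ b i + ∑ e, B i e * (if x e then (1 : ℝ) else 0) := by
  classical
  intro c
  filter_upwards [h (c + 3), Filter.eventually_ge_atTop 4] with m hm hm4 p q hpq A b B hB hcomp
  obtain ⟨ε, hε, U, V, hU, hV, hfact⟩ := lpGate_cliqueDist_factorisation A b B hB hcomp
  -- re-index the terms by `Fin`
  set eL := Fintype.equivFin ((Fin p ⊕ Fin q) ⊕ (((⊤ : SimpleGraph (Fin m)).edgeSet ⊕ (⊤ : SimpleGraph (Fin m)).edgeSet) ⊕ Unit)) with heL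
  have hcard : Fintype.card ((Fin p ⊕ Fin q) ⊕ (((⊤ : SimpleGraph (Fin m)).edgeSet ⊕ (⊤ : SimpleGraph (Fin m)).edgeSet) ⊕ Unit)) ≤ m ^ (c + 3) := by
    have hn : Fintype.card (⊤ : SimpleGraph (Fin m)).edgeSet ≤ m ^ 2 := card_edgeSet_top_le m
    simp only [Fintype.card_sum, Fintype.card_fin, Fintype.card_unique]
    have h1 : 1 ≤ m := by omega
    have e1 : m ^ c ≤ m ^ (c + 2) := Nat.pow_le_pow_right h1 (by omega)
    have e2 : m ^ 2 ≤ m ^ (c + 2) := Nat.pow_le_pow_right h1 (by omega)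
    have e3 : 1 ≤ m ^ (c + 2) := Nat.one_le_pow _ _ h1
    have e4 : 4 * m ^ (c + 2) ≤ m ^ (c + 3) := by
      calc 4 * m ^ (c + 2) = m ^ (c + 2) * 4 := Nat.mul_comm _ _
        _ ≤ m ^ (c + 2) * m := Nat.mul_le_mul_left _ hm4
        _ = m ^ (c + 3) := (pow_succ m (c + 2)).symm
    omega
  refine hm ε hε _ hcard (fun u i => U u (eL.symm i)) (fun i Q => V (eL.symm i) Q)
    (fun u i => hU u _) (fun i Q => hV _ Q) fun Q u hQ hu => ?_
  rw [hfact Q u hQ hu]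
  exact (Equiv.sum_comp eL.symm (fun l => U u l * V l Q)).symm

end Summit.PneNP.PneNP.Theorems
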